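import Summits.ResolutionOfSingularities.ResolutionOfSingularities.Theorems.FrobeniusLadderFInjectiveMacaulayficationDominatingLocFix
import Summits.ResolutionOfSingularities.ResolutionOfSingularities.Theorems.FrobeniusLadderFInjectiveMacaulayficationSpreadSupportControl
import HarnessLib

/-!
# Dominating cure near `ζ` with SUPPORT-CONTROLLED auxiliary centre `J″ ⊆ Z` (cluster growth: explicit junk region)
# (crux `FInjectiveMacaulayfication` stmt-ResolutionOfSingularities-15315, chain w45a; res-L1-w45a-plan-1 R16.45 (2) corollary
# `exists_dominating_goodOver_nhd_support_subset` = res-L1-w45a-stub-1's (c) `DominatingLocFix.exists_dominating_goodOver_nhd` (p576038) with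
# `supp J″ ⊆ Z`; seat res-L1-w45a-stub-2)

[OURS · L1 W4.5a] Support file (`--supports stmt-ResolutionOfSingularities-15315 --as helper`); NOT a statement of any manuscript; def-free; CONDITIONAL on
`NonFullLocusClosed` (resp. the two printed openness theorems BY NAME); AI-written (AI review is weaker than expert review).

`exists_dominating_goodOver_nhd_support_subset`: as stub-1's (c) — given `J₀ ≠ ⊥`, germs `c` at `ζ` with `(c) ≠ ⊥`, generators `d` of `J₀,ζ·(c)` whose
blow-up charts are FULL over `𝔪_ζ` — PLUS a closed `Z ⊆ X₁` with `(I_Z)_ζ ⊆ √(c)`: then the auxiliary centre `J″` (with `J″_ζ = (c)`) can be taken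
SUPPORTED INSIDE `Z` (`SpreadSupportControl.exists_spread_support_subset_of_le_radical`), and every blow-up along `J₀·J″` is FULL over an open
`U ∋ ζ` (`DominatingLocFix.goodOver_nhd_of_locGood`). So a cluster-growth step re-blows the old good region only inside `Z`.
[cite: DattaMurayama2024, Thm. B]
-/

-- single-problem summit: the doubled namespace component is forced
set_option linter.dupNamespace false

noncomputable section

namespace Summit.ResolutionOfSingularities.ResolutionOfSingularities.Theorems.FInjectiveMacaulayfication.DominatingLocFixSupport

open CategoryTheory AlgebraicGeometry TopologicalSpace IsLocalRing
open Literature.AlgebraicGeometry.Resolution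
open Summit.ResolutionOfSingularities.ResolutionOfSingularities.Theorems.FInjectiveMacaulayfication
open FCUnguardedAprime SliceableCentre

/-- **Dominating cure with support-controlled auxiliary centre.** [OURS · conditional on `NonFullLocusClosed`] -/
theorem exists_dominating_goodOver_nhd_support_subset (hNF : NonFullLocusClosed.NonFullLocusClosed)
    (p : ℕ) (hp : p.Prime) (k : Type) [Field k] [CharP k p] (X₁ : Scheme.{0}) (f₁ : X₁ ⟶ Spec (.of k))
    [LocallyOfFiniteType f₁] [QuasiCompact f₁] [IsIntegral X₁]
    (J₀ : X₁.IdealSheafData) (hJ₀ : J₀ ≠ ⊥) (ζ : X₁) {m : ℕ} (c : Fin m → X₁.presheaf.stalk ζ)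
    (hc0 : Ideal.span (Set.range c) ≠ ⊥) {n : ℕ} (d : Fin n → X₁.presheaf.stalk ζ)
    (hd : Ideal.span (Set.range d) = stalkIdeal J₀ ζ * Ideal.span (Set.range c))
    (hfull : ∀ (j : Fin n) (𝔔 : PrimeSpectrum (blowupAlgebra (Ideal.span (Set.range d)) (d j))),
      𝔔.asIdeal.comap (algebraMap (X₁.presheaf.stalk ζ) (blowupAlgebra (Ideal.span (Set.range d)) (d j))) =
        maximalIdeal (X₁.presheaf.stalk ζ) → FullCl p (Localization.AtPrime 𝔔.asIdeal))
    (Z : Set X₁) (hZ : IsClosed Z)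
    (hrad : stalkIdeal (Scheme.IdealSheafData.vanishingIdeal ⟨Z, hZ⟩) ζ ≤ (Ideal.span (Set.range c)).radical) :
    ∃ (J'' : X₁.IdealSheafData) (U : X₁.Opens), J'' ≠ ⊥ ∧ stalkIdeal J'' ζ = Ideal.span (Set.range c) ∧ (J''.support : Set X₁) ⊆ Z ∧
      ζ ∈ (U : Set X₁) ∧
      (∀ (X₂ : Scheme.{0}) (π : X₂ ⟶ X₁), IsBlowup π (J₀ * J'') → ∀ x : X₂, π.base x ∈ (U : Set X₁) → FullCl p (X₂.presheaf.stalk x)) ∧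
      GoodOver p X₁ (J₀ * J'') (U : Set X₁) := by
  classical
  haveI : IsNoetherian X₁ := ClosedPointsOfClosedFinite.isNoetherian_of_locallyOfFiniteType_of_quasiCompact f₁
  -- the support-controlled spread of `(c)`
  obtain ⟨J'', hJ''ζ, hJ''Z⟩ := SpreadSupportControl.exists_spread_support_subset_of_le_radical Z hZ c hrad
  have hJ'' : J'' ≠ ⊥ := by
    intro h
    apply hc0
    rw [← hJ''ζ, h]
    exact stalkIdeal_bot ζ
  -- the product is nonzero (stalks of an integral scheme are domains)
  have hprod : J₀ * J'' ≠ ⊥ := by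
    intro h0
    have h1 : stalkIdeal (J₀ * J'') ζ = ⊥ := by rw [h0]; exact stalkIdeal_bot ζ
    rw [stalkIdeal_mul] at h1
    rcases Ideal.mul_eq_bot.mp h1 with h | h
    · exact stalkIdeal_ne_bot_of_ne_bot hJ₀ ζ h
    · exact stalkIdeal_ne_bot_of_ne_bot hJ'' ζ h
  have hdζ : Ideal.span (Set.range d) = stalkIdeal (J₀ * J'') ζ := by rw [stalkIdeal_mul, hJ''ζ, hd]
  obtain ⟨U, hζU, hU, hgood⟩ := DominatingLocFix.goodOver_nhd_of_locGood hNF p hp k X₁ f₁ (J₀ * J'') hprod ζ d hdζ hfull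
  exact ⟨J'', U, hJ'', hJ''ζ, hJ''Z, hζU, hU, hgood⟩

/-- The same from the two printed openness theorems BY NAME (Datta–Murayama 2024 Thm. B; openness of the Cohen–Macaulay locus).
[OURS · conditional-result] [cite: DattaMurayama2024, Thm. B] -/
theorem exists_dominating_goodOver_nhd_support_subset_of_DM_CMLocusOpen
    (hDM : Literature.AlgebraicGeometry.Resolution.DattaMurayama2024_fInjectiveLocusOpen.{0})
    (hCMo : NonFullLocusClosed.CMLocusOpen)
    (p : ℕ) (hp : p.Prime) (k : Type) [Field k] [CharP k p] (X₁ : Scheme.{0}) (f₁ : X₁ ⟶ Spec (.of k))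
    [LocallyOfFiniteType f₁] [QuasiCompact f₁] [IsIntegral X₁]
    (J₀ : X₁.IdealSheafData) (hJ₀ : J₀ ≠ ⊥) (ζ : X₁) {m : ℕ} (c : Fin m → X₁.presheaf.stalk ζ)
    (hc0 : Ideal.span (Set.range c) ≠ ⊥) {n : ℕ} (d : Fin n → X₁.presheaf.stalk ζ)
    (hd : Ideal.span (Set.range d) = stalkIdeal J₀ ζ * Ideal.span (Set.range c))
    (hfull : ∀ (j : Fin n) (𝔔 : PrimeSpectrum (blowupAlgebra (Ideal.span (Set.range d)) (d j))),
      𝔔.asIdeal.comap (algebraMap (X₁.presheaf.stalk ζ) (blowupAlgebra (Ideal.span (Set.range d)) (d j))) =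
        maximalIdeal (X₁.presheaf.stalk ζ) → FullCl p (Localization.AtPrime 𝔔.asIdeal))
    (Z : Set X₁) (hZ : IsClosed Z)
    (hrad : stalkIdeal (Scheme.IdealSheafData.vanishingIdeal ⟨Z, hZ⟩) ζ ≤ (Ideal.span (Set.range c)).radical) :
    ∃ (J'' : X₁.IdealSheafData) (U : X₁.Opens), J'' ≠ ⊥ ∧ stalkIdeal J'' ζ = Ideal.span (Set.range c) ∧ (J''.support : Set X₁) ⊆ Z ∧
      ζ ∈ (U : Set X₁) ∧
      (∀ (X₂ : Scheme.{0}) (π : X₂ ⟶ X₁), IsBlowup π (J₀ * J'') → ∀ x : X₂, π.base x ∈ (U : Set X₁) → FullCl p (X₂.presheaf.stalk x)) ∧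
      GoodOver p X₁ (J₀ * J'') (U : Set X₁) :=
  exists_dominating_goodOver_nhd_support_subset (NonFullLocusClosed.nonFullLocusClosed_of_named hDM hCMo)
    p hp k X₁ f₁ J₀ hJ₀ ζ c hc0 d hd hfull Z hZ hrad

end Summit.ResolutionOfSingularities.ResolutionOfSingularities.Theorems.FInjectiveMacaulayfication.DominatingLocFixSupport

end
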